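import Summits.Ventures.CertifiedManyBodySolver.Theorems.CovNdNiO2M22ResidualLowUSlab22
import Summits.Ventures.CertifiedManyBodySolver.Theorems.CovNdNiO2M22ResidualHighUSlab22
import HarnessLib
import HarnessLib.Audit

/-!
# Ventures/CertifiedManyBodySolver — Theorems/CovNdNiO2M22LeafOfPairNodes.lean — «LEAF CAPSTONE» of route CovNdNiO2M22 (PEN RULING (kkkk) d333 (4))

HONEST FRAMING: the RUNG LEAF «MOS2-ndnio2-M22» `Observables.NdNiO2M22_StiffnessBoxCeiling` (certified T = 0 uniform-flux stiffness CEILING `≤ 0.4418857 = 0.98 ×` the box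
kinematic word κ₂₂ = 0.4509038 on the WHOLE downfolded box `boxNdSrNiO2E_M22` of the Sr-doped infinite-layer film Nd₀.₈Sr₀.₂NiO₂ (VSET M22, router/BOXES/NdNiO2.md),
SCREENING-GRADE) **MODULO EXACTLY THE THREE SDP PAIR CLAIM NODES** of route-Ventures-CovNdNiO2M22's rows of record — the route's DECIDING theorem
`Theses.CovNdNiO2M22.closes` (planner; the Assembly item stmt-Ventures-23947 is its curried form, `covNdNiO2M22Assembly_proof` p694044) composed with hubbard-cov-ndnio2-unc-3's two
conditional closers `covNdNiO2M22_ResidualLowUSlab22_of_pairNodes_AF` (LOW slab U ∈ [5, 110/21], rows B + C) and `covNdNiO2M22_ResidualHighUSlab22_of_pairNodes_AF` (HIGH slab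
U ∈ [110/21, 17/2], rows A + B; p692859). Nothing is «proved» unconditionally: the three hypotheses are `@[conjecture]` PINNED t′-PAIR claim nodes typed straight from two
exact-rational SDP dual certificates each (hub ⊕ pinned spoke, checked OUTSIDE Lean by two code-disjoint exact readers + referee replay; no in-kernel SDP checker):
segment A `[−276/425, −11/20]` = `cert_ndBoxE_n409o500_pairAP_om23o50_j320111` (hub H1 j316626 ⊕ spoke S1 j320111; p690365; row word 0.4299698, margin 0.0119159 — the binding
object), segment B `[−11/20, −23/50]` = `cert_ndBoxE_n409o500_pairBP_om23o50_j320777` (H2 j316629 ⊕ S2 j320777; p692258; 0.4251752, margin 0.0167105), segment C `[−23/50, −11/25]` =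
`cert_ndBoxE_n409o500_pairCP_om23o50_j320839` (H3 j316631 ⊕ S3 j320839; p694694; 0.4173548, margin 0.0245309); their bundle rows are THEOREMS of the nodes by the kernel t′-pair law
(p662147), keyed at hubbard-cov-ndnio2-unc-1's NODE-FREE station-5 chord caps (p662195), so NO cap node enters; the `Q = −X₀(−11/25)` rows are the kinematic theorem
`ndM22_QRowWN_kinematic`; the rest of the box is node-free kinematics (`NdNiO2M22_StiffnessBoxCeiling_of_cornerCellLeaf`, box-2). CONTROL / CALIBRATION class (xx1) + labelled
heuristic; «closed modulo nodes» ≠ proved; a ceiling never speaks to the presence or absence of superconductivity; not a `T_c` or phase-diagram statement; never «certified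
true negative / positive»; no summit statement is proved here (Ventures has none; this is a rung leaf, D-0061). Cell `hubbard-obs` (MO-S2), seat `hubbard-cov-ndnio2-box-1` (g3);
M21 twin: `ndNiO2M21_StiffnessBoxCeiling_of_bundleNodes_AF` (p659004). Zero compute; one term.
References: T. Koma, H. Tasaki, J. Stat. Phys. 76 (1994) 745, §1 [KomaTasaki1994]; D. J. Scalapino, S. R. White, S.-C. Zhang, PRB 47 (1993) 7995, §II [ScalapinoWhiteZhang1993].
-/

noncomputable section

namespace Summit.Ventures.CertifiedManyBodySolver.Theorems

open Summit.Ventures.CertifiedManyBodySolver.Observables Summit.Ventures.CertifiedManyBodySolver.Certificates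

/-- **THE RUNG LEAF «MOS2-ndnio2-M22» MODULO THE THREE PAIR CLAIM NODES (node-free cap edition):** `NdNiO2M22_StiffnessBoxCeiling` from the segment-A (H1 ⊕ S1),
segment-B (H2 ⊕ S2) and segment-C (H3 ⊕ S3) pinned-pair nodes, via the route's deciding theorem `closes` and the two «closed modulo nodes» closers (LOW ⇐ B, C; HIGH ⇐ A, B).
[cite: KomaTasaki1994, §1] [cite: ScalapinoWhiteZhang1993, §II] -/
theorem ndNiO2M22_StiffnessBoxCeiling_of_pairNodes_AF
    (hA : cert_ndBoxE_n409o500_pairAP_om23o50_j320111)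
    (hB : cert_ndBoxE_n409o500_pairBP_om23o50_j320777)
    (hC : cert_ndBoxE_n409o500_pairCP_om23o50_j320839) :
    Summit.Ventures.CertifiedManyBodySolver.Observables.NdNiO2M22_StiffnessBoxCeiling :=
  Summit.Ventures.CertifiedManyBodySolver.Theses.CovNdNiO2M22.closes
    (covNdNiO2M22_ResidualLowUSlab22_of_pairNodes_AF hB hC) (covNdNiO2M22_ResidualHighUSlab22_of_pairNodes_AF hA hB)

end Summit.Ventures.CertifiedManyBodySolver.Theorems

end
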